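import Mathlib
import Summits.Ventures.PercRepro.TriangleCapStar
import Summits.Ventures.PercRepro.TriangleCapRowPlusOne

/-!
# PercRepro — the row `m = k + 1` is exact: the star plus two disjoint leaf edges attains `C(k − 1, 2) + 4`
(p3, gen 30; the companion of TriangleCapRowPlusOne)

* `starPlusTwo k` — the star `K_{1,k−1}` with centre `0` plus the leaf edges `{1, 2}` and `{3, 4}` on `Fin k`,
  with its decidable adjacency (`decidableRelStarPlusTwo`) and `starPlusTwo_adj`;
* `k4mFree_starPlusTwo` — it is `K₄⁻`-free: the adjacent ordered pairs inside a `4`-set have the centre as a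
  coordinate (at most `2 · 1 · 3`) or lie in the off-diagonals of `S ∩ {1, 2}` and `S ∩ {3, 4}`, and these two
  traces are disjoint subsets of `S ∖ {0}`;
* the degrees (`deg_starPlusTwo`, for `k ≥ 5`): `k − 1` at the centre, `2` at `1, 2, 3, 4`, `1` elsewhere;
  `cherries_starPlusTwo = C(k − 1, 2) + 4`, `sum_deg_starPlusTwo = 2k + 2`, `card_edges_starPlusTwo = k + 1`;
* **`exists_k4mFree_row_plus_one`** / **`row_plus_one_exact`** — for every `k ≥ 5` the `K₄⁻`-free cherry maximum at
  `(k, k + 1)` is exactly `C(k − 1, 2) + 4`; `row_plus_one_values` — the table's `10 · 14 · 19 · 25 · 32` at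
  `k = 5 … 9`.

Axioms: standard.
-/

namespace PercRepro

namespace TriangleCap

namespace C047

open Finset

/-- The star with centre `0` plus the two disjoint leaf edges `{1, 2}` and `{3, 4}` (a graph on `Fin k` for every
`k`). -/
def starPlusTwo (k : ℕ) : SimpleGraph (Fin k) where
  Adj i j := (i.val = 0 ∧ j.val ≠ 0) ∨ (j.val = 0 ∧ i.val ≠ 0) ∨ (i.val = 1 ∧ j.val = 2) ∨
    (i.val = 2 ∧ j.val = 1) ∨ (i.val = 3 ∧ j.val = 4) ∨ (i.val = 4 ∧ j.val = 3)
  symm := ⟨fun i j h => by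
    rcases h with ⟨h1, h2⟩ | ⟨h1, h2⟩ | ⟨h1, h2⟩ | ⟨h1, h2⟩ | ⟨h1, h2⟩ | ⟨h1, h2⟩
    · exact Or.inr (Or.inl ⟨h1, h2⟩)
    · exact Or.inl ⟨h1, h2⟩
    · exact Or.inr (Or.inr (Or.inr (Or.inl ⟨h2, h1⟩)))
    · exact Or.inr (Or.inr (Or.inl ⟨h2, h1⟩))
    · exact Or.inr (Or.inr (Or.inr (Or.inr (Or.inr ⟨h2, h1⟩))))
    · exact Or.inr (Or.inr (Or.inr (Or.inr (Or.inl ⟨h2, h1⟩))))⟩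
  loopless := ⟨fun i h => by
    rcases h with ⟨h1, h2⟩ | ⟨h1, h2⟩ | ⟨h1, h2⟩ | ⟨h1, h2⟩ | ⟨h1, h2⟩ | ⟨h1, h2⟩ <;> omega⟩

/-- Adjacency in `starPlusTwo k` is decidable. -/
instance decidableRelStarPlusTwo (k : ℕ) : DecidableRel (starPlusTwo k).Adj :=
  fun i j => inferInstanceAs (Decidable ((i.val = 0 ∧ j.val ≠ 0) ∨ (j.val = 0 ∧ i.val ≠ 0) ∨
    (i.val = 1 ∧ j.val = 2) ∨ (i.val = 2 ∧ j.val = 1) ∨ (i.val = 3 ∧ j.val = 4) ∨ (i.val = 4 ∧ j.val = 3)))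

/-- Adjacency in `starPlusTwo k`, unfolded. -/
theorem starPlusTwo_adj (k : ℕ) (i j : Fin k) :
    (starPlusTwo k).Adj i j ↔ (i.val = 0 ∧ j.val ≠ 0) ∨ (j.val = 0 ∧ i.val ≠ 0) ∨
      (i.val = 1 ∧ j.val = 2) ∨ (i.val = 2 ∧ j.val = 1) ∨ (i.val = 3 ∧ j.val = 4) ∨
      (i.val = 4 ∧ j.val = 3) := Iff.rfl

/-- The adjacent ordered pairs inside `S` have the centre as a coordinate (the other off the centre) or lie in the
off-diagonal of `S ∩ {1, 2}` or of `S ∩ {3, 4}`. -/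
theorem adjPairs_starPlusTwo_le (k : ℕ) (S : Finset (Fin k)) :
    adjPairs (starPlusTwo k) S ≤
      2 * ((S.filter (fun i : Fin k => i.val = 0)).card * (S.filter (fun i : Fin k => ¬ i.val = 0)).card) +
        (S.filter (fun i : Fin k => i.val = 1 ∨ i.val = 2)).offDiag.card +
        (S.filter (fun i : Fin k => i.val = 3 ∨ i.val = 4)).offDiag.card := by
  unfold adjPairs
  set C := S.filter (fun i : Fin k => i.val = 0) with hC
  set S' := S.filter (fun i : Fin k => ¬ i.val = 0) with hS'
  set P := S.filter (fun i : Fin k => i.val = 1 ∨ i.val = 2) with hP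
  set Q := S.filter (fun i : Fin k => i.val = 3 ∨ i.val = 4) with hQ
  have hsub : (S ×ˢ S).filter (fun p => (starPlusTwo k).Adj p.1 p.2) ⊆
      C ×ˢ S' ∪ S' ×ˢ C ∪ P.offDiag ∪ Q.offDiag := by
    intro p hp
    rw [mem_filter, mem_product] at hp
    obtain ⟨⟨h1, h2⟩, hadj⟩ := hp
    rw [starPlusTwo_adj] at hadj
    rw [mem_union, mem_union, mem_union, mem_product, mem_product, mem_offDiag, mem_offDiag, hC, hS', hP,
      hQ, mem_filter, mem_filter, mem_filter, mem_filter, mem_filter, mem_filter, mem_filter, mem_filter]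
    rcases hadj with ⟨ha, hb⟩ | ⟨ha, hb⟩ | ⟨ha, hb⟩ | ⟨ha, hb⟩ | ⟨ha, hb⟩ | ⟨ha, hb⟩
    · exact Or.inl (Or.inl (Or.inl ⟨⟨h1, ha⟩, ⟨h2, hb⟩⟩))
    · exact Or.inl (Or.inl (Or.inr ⟨⟨h1, hb⟩, ⟨h2, ha⟩⟩))
    · exact Or.inl (Or.inr ⟨⟨h1, Or.inl ha⟩, ⟨h2, Or.inr hb⟩, fun h => by rw [h] at ha; omega⟩)
    · exact Or.inl (Or.inr ⟨⟨h1, Or.inr ha⟩, ⟨h2, Or.inl hb⟩, fun h => by rw [h] at ha; omega⟩)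
    · exact Or.inr ⟨⟨h1, Or.inl ha⟩, ⟨h2, Or.inr hb⟩, fun h => by rw [h] at ha; omega⟩
    · exact Or.inr ⟨⟨h1, Or.inr ha⟩, ⟨h2, Or.inl hb⟩, fun h => by rw [h] at ha; omega⟩
  calc ((S ×ˢ S).filter (fun p => (starPlusTwo k).Adj p.1 p.2)).card
      ≤ (C ×ˢ S' ∪ S' ×ˢ C ∪ P.offDiag ∪ Q.offDiag).card := card_le_card hsub
    _ ≤ (C ×ˢ S' ∪ S' ×ˢ C ∪ P.offDiag).card + Q.offDiag.card := card_union_le _ _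
    _ ≤ (C ×ˢ S' ∪ S' ×ˢ C).card + P.offDiag.card + Q.offDiag.card := by
        gcongr; exact card_union_le _ _
    _ ≤ (C ×ˢ S').card + (S' ×ˢ C).card + P.offDiag.card + Q.offDiag.card := by
        gcongr; exact card_union_le _ _
    _ = 2 * (C.card * S'.card) + P.offDiag.card + Q.offDiag.card := by
        rw [card_product, card_product]; ring

/-- The traces of `S` on `{1, 2}` and on `{3, 4}` are disjoint subsets of `S ∖ {0}`. -/
theorem card_filter_add_card_filter_le (k : ℕ) (S : Finset (Fin k)) :
    (S.filter (fun i : Fin k => i.val = 1 ∨ i.val = 2)).card +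
        (S.filter (fun i : Fin k => i.val = 3 ∨ i.val = 4)).card ≤
      (S.filter (fun i : Fin k => ¬ i.val = 0)).card := by
  rw [← card_union_of_disjoint]
  · apply card_le_card
    intro i hi
    rw [mem_union, mem_filter, mem_filter] at hi
    rw [mem_filter]
    rcases hi with ⟨h1, h2⟩ | ⟨h1, h2⟩
    · exact ⟨h1, by omega⟩
    · exact ⟨h1, by omega⟩
  · rw [disjoint_left]
    intro i hi hi'
    rw [mem_filter] at hi hi'
    omega

/-- **`starPlusTwo k` is `K₄⁻`-free.** -/
theorem k4mFree_starPlusTwo (k : ℕ) : K4mFree (starPlusTwo k) := by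
  intro S hS
  have h := adjPairs_starPlusTwo_le k S
  have hsum := card_filter_add_card_filter_not (s := S) (fun i : Fin k => i.val = 0)
  rw [hS] at hsum
  have hC : (S.filter (fun i : Fin k => i.val = 0)).card ≤ 1 := card_filter_val_eq_le_one k 0 S
  have hP : (S.filter (fun i : Fin k => i.val = 1 ∨ i.val = 2)).card ≤ 2 := by
    rw [filter_or]
    exact (card_union_le _ _).trans
      (Nat.add_le_add (card_filter_val_eq_le_one k 1 S) (card_filter_val_eq_le_one k 2 S))
  have hQ : (S.filter (fun i : Fin k => i.val = 3 ∨ i.val = 4)).card ≤ 2 := by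
    rw [filter_or]
    exact (card_union_le _ _).trans
      (Nat.add_le_add (card_filter_val_eq_le_one k 3 S) (card_filter_val_eq_le_one k 4 S))
  have hPQ := card_filter_add_card_filter_le k S
  rw [offDiag_card, offDiag_card] at h
  set x := (S.filter (fun i : Fin k => i.val = 0)).card with hx
  set y := (S.filter (fun i : Fin k => ¬ i.val = 0)).card with hy
  set p := (S.filter (fun i : Fin k => i.val = 1 ∨ i.val = 2)).card with hp
  set q := (S.filter (fun i : Fin k => i.val = 3 ∨ i.val = 4)).card with hq
  clear_value x y p q
  interval_cases x <;> interval_cases p <;> interval_cases q <;> omega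

/-- The neighbours of the centre are all the other vertices. -/
theorem filter_adj_starPlusTwo_centre (k : ℕ) (c : Fin k) (hc : c.val = 0) :
    univ.filter (fun w => (starPlusTwo k).Adj c w) = univ.erase c := by
  ext w
  rw [mem_filter, mem_erase, starPlusTwo_adj]
  constructor
  · rintro ⟨_, (⟨_, h2⟩ | ⟨h1, h2⟩ | ⟨h1, _⟩ | ⟨h1, _⟩ | ⟨h1, _⟩ | ⟨h1, _⟩)⟩
    · exact ⟨fun h => h2 (by rw [h]; exact hc), mem_univ _⟩
    all_goals omega
  · rintro ⟨hne, _⟩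
    exact ⟨mem_univ _, Or.inl ⟨hc, fun h => hne (Fin.ext (h.trans hc.symm))⟩⟩

/-- The centre has degree `k − 1`. -/
theorem deg_starPlusTwo_centre (k : ℕ) (c : Fin k) (hc : c.val = 0) :
    deg (starPlusTwo k) c = k - 1 := by
  unfold deg
  rw [filter_adj_starPlusTwo_centre k c hc, card_erase_of_mem (mem_univ c), card_univ, Fintype.card_fin]

/-- The neighbours of the leaf `1` are `0` and `2` (`k ≥ 5`). -/
theorem filter_adj_starPlusTwo_one (k : ℕ) (hk : 5 ≤ k) :
    univ.filter (fun w => (starPlusTwo k).Adj ⟨1, by omega⟩ w) =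
      {(⟨0, by omega⟩ : Fin k), ⟨2, by omega⟩} := by
  ext w
  rw [mem_filter, starPlusTwo_adj, mem_insert, mem_singleton, Fin.ext_iff, Fin.ext_iff]
  simp only [mem_univ, true_and]
  omega

/-- The neighbours of the leaf `2` are `0` and `1` (`k ≥ 5`). -/
theorem filter_adj_starPlusTwo_two (k : ℕ) (hk : 5 ≤ k) :
    univ.filter (fun w => (starPlusTwo k).Adj ⟨2, by omega⟩ w) =
      {(⟨0, by omega⟩ : Fin k), ⟨1, by omega⟩} := by
  ext w
  rw [mem_filter, starPlusTwo_adj, mem_insert, mem_singleton, Fin.ext_iff, Fin.ext_iff]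
  simp only [mem_univ, true_and]
  omega

/-- The neighbours of the leaf `3` are `0` and `4` (`k ≥ 5`). -/
theorem filter_adj_starPlusTwo_three (k : ℕ) (hk : 5 ≤ k) :
    univ.filter (fun w => (starPlusTwo k).Adj ⟨3, by omega⟩ w) =
      {(⟨0, by omega⟩ : Fin k), ⟨4, by omega⟩} := by
  ext w
  rw [mem_filter, starPlusTwo_adj, mem_insert, mem_singleton, Fin.ext_iff, Fin.ext_iff]
  simp only [mem_univ, true_and]
  omega

/-- The neighbours of the leaf `4` are `0` and `3` (`k ≥ 5`). -/
theorem filter_adj_starPlusTwo_four (k : ℕ) (hk : 5 ≤ k) :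
    univ.filter (fun w => (starPlusTwo k).Adj ⟨4, by omega⟩ w) =
      {(⟨0, by omega⟩ : Fin k), ⟨3, by omega⟩} := by
  ext w
  rw [mem_filter, starPlusTwo_adj, mem_insert, mem_singleton, Fin.ext_iff, Fin.ext_iff]
  simp only [mem_univ, true_and]
  omega

/-- A leaf `1 ≤ v ≤ 4` has degree `2` (`k ≥ 5`). -/
theorem deg_starPlusTwo_leaf (k : ℕ) (hk : 5 ≤ k) (v : Fin k) (hv1 : 1 ≤ v.val) (hv4 : v.val ≤ 4) :
    deg (starPlusTwo k) v = 2 := by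
  unfold deg
  have h : v.val = 1 ∨ v.val = 2 ∨ v.val = 3 ∨ v.val = 4 := by omega
  rcases h with h | h | h | h
  · have hv : v = ⟨1, by omega⟩ := Fin.ext h
    rw [hv, filter_adj_starPlusTwo_one k hk, card_pair]
    simp [Fin.ext_iff]
  · have hv : v = ⟨2, by omega⟩ := Fin.ext h
    rw [hv, filter_adj_starPlusTwo_two k hk, card_pair]
    simp [Fin.ext_iff]
  · have hv : v = ⟨3, by omega⟩ := Fin.ext h
    rw [hv, filter_adj_starPlusTwo_three k hk, card_pair]
    simp [Fin.ext_iff]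
  · have hv : v = ⟨4, by omega⟩ := Fin.ext h
    rw [hv, filter_adj_starPlusTwo_four k hk, card_pair]
    simp [Fin.ext_iff]

/-- The neighbours of a vertex `v ≥ 5` lie in `{0}`. -/
theorem filter_adj_starPlusTwo_far_subset (k : ℕ) (v : Fin k) (hv : 5 ≤ v.val) :
    univ.filter (fun w => (starPlusTwo k).Adj v w) ⊆ univ.filter (fun i : Fin k => i.val = 0) := by
  intro w hw
  rw [mem_filter, starPlusTwo_adj] at hw
  rw [mem_filter]
  refine ⟨mem_univ _, ?_⟩
  rcases hw.2 with ⟨h1, _⟩ | ⟨h1, _⟩ | ⟨h1, _⟩ | ⟨h1, _⟩ | ⟨h1, _⟩ | ⟨h1, _⟩ <;> omega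

/-- A vertex `v ≥ 5` has degree exactly `1` (it sees the centre). -/
theorem deg_starPlusTwo_far (k : ℕ) (v : Fin k) (hv : 5 ≤ v.val) : deg (starPlusTwo k) v = 1 := by
  have hle : deg (starPlusTwo k) v ≤ 1 :=
    (card_le_card (filter_adj_starPlusTwo_far_subset k v hv)).trans (card_filter_val_eq_le_one k 0 univ)
  have hpos : 1 ≤ deg (starPlusTwo k) v := by
    unfold deg
    rw [Nat.one_le_iff_ne_zero, ← pos_iff_ne_zero, card_pos]
    exact ⟨⟨0, by omega⟩, by
      rw [mem_filter, starPlusTwo_adj]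
      exact ⟨mem_univ _, Or.inr (Or.inl ⟨rfl, by omega⟩)⟩⟩
  omega

/-- The degree of every vertex of `starPlusTwo k` (`k ≥ 5`), as a function of its value. -/
theorem deg_starPlusTwo (k : ℕ) (hk : 5 ≤ k) (v : Fin k) :
    deg (starPlusTwo k) v = if v.val = 0 then k - 1 else if v.val ≤ 4 then 2 else 1 := by
  split_ifs with h0 h4
  · exact deg_starPlusTwo_centre k v h0
  · exact deg_starPlusTwo_leaf k hk v (by omega) h4
  · exact deg_starPlusTwo_far k v (by omega)

/-- `Σ_v C(d(v), 2) = C(k − 1, 2) + 4` on `starPlusTwo k` (`k ≥ 5`). -/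
theorem cherries_starPlusTwo (k : ℕ) (hk : 5 ≤ k) :
    cherries (starPlusTwo k) = (k - 1).choose 2 + 4 := by
  unfold cherries
  rw [sum_congr rfl (fun v _ => by rw [deg_starPlusTwo k hk v])]
  rw [Fin.sum_univ_eq_sum_range
    (fun i => (if i = 0 then k - 1 else if i ≤ 4 then 2 else 1).choose 2) k]
  obtain ⟨j, rfl⟩ : ∃ j, k = j + 5 := ⟨k - 5, by omega⟩
  rw [add_comm j 5, sum_range_add]
  have hrest : ∑ x ∈ range j, (if 5 + x = 0 then 5 + j - 1 else if 5 + x ≤ 4 then 2 else 1).choose 2 = 0 := by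
    apply sum_eq_zero
    intro x _
    rw [if_neg (by omega), if_neg (by omega)]
    rfl
  rw [hrest, sum_range_succ, sum_range_succ, sum_range_succ, sum_range_succ, sum_range_succ,
    sum_range_zero]
  norm_num

/-- `Σ_v d(v) = 2k + 2` on `starPlusTwo k` (`k ≥ 5`). -/
theorem sum_deg_starPlusTwo (k : ℕ) (hk : 5 ≤ k) : ∑ v, deg (starPlusTwo k) v = 2 * k + 2 := by
  rw [sum_congr rfl (fun v _ => by rw [deg_starPlusTwo k hk v])]
  rw [Fin.sum_univ_eq_sum_range (fun i => if i = 0 then k - 1 else if i ≤ 4 then 2 else 1) k]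
  obtain ⟨j, rfl⟩ : ∃ j, k = j + 5 := ⟨k - 5, by omega⟩
  rw [add_comm j 5, sum_range_add]
  have hrest : ∑ x ∈ range j, (if 5 + x = 0 then 5 + j - 1 else if 5 + x ≤ 4 then 2 else 1) = j := by
    rw [sum_congr rfl (fun x _ => by rw [if_neg (by omega), if_neg (by omega)])]
    rw [sum_const, card_range, smul_eq_mul, mul_one]
  rw [hrest, sum_range_succ, sum_range_succ, sum_range_succ, sum_range_succ, sum_range_succ,
    sum_range_zero]
  norm_num
  omega

/-- `starPlusTwo k` has `k + 1` edges (handshake; `k ≥ 5`). -/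
theorem card_edges_starPlusTwo (k : ℕ) (hk : 5 ≤ k) : (starPlusTwo k).edgeFinset.card = k + 1 := by
  have h := sum_deg_eq (starPlusTwo k)
  rw [sum_deg_starPlusTwo k hk] at h
  omega

/-- **THE ROW `m = k + 1` IS ATTAINED:** for `k ≥ 5` a `K₄⁻`-free graph on `Fin k` with `k + 1` edges and
`Σ_v C(d(v), 2) = C(k − 1, 2) + 4`. -/
theorem exists_k4mFree_row_plus_one (k : ℕ) (hk : 5 ≤ k) :
    ∃ (D : SimpleGraph (Fin k)) (_ : DecidableRel D.Adj),
      K4mFree D ∧ D.edgeFinset.card = k + 1 ∧ cherries D = (k - 1).choose 2 + 4 :=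
  ⟨starPlusTwo k, inferInstance, k4mFree_starPlusTwo k, card_edges_starPlusTwo k hk,
    cherries_starPlusTwo k hk⟩

/-- The row bound on `Fin k`. -/
theorem cherries_le_of_card_edges_eq_succ (k : ℕ) (D : SimpleGraph (Fin k)) [DecidableRel D.Adj]
    (hK : K4mFree D) (hm : D.edgeFinset.card = k + 1) : cherries D ≤ (k - 1).choose 2 + 4 := by
  have h := cherries_le_choose_two_add_four_of_k4mFree D hK (by rw [hm, Fintype.card_fin])
  rwa [Fintype.card_fin] at h

/-- **THE ROWS `m = k + 1` ARE SOLVED EXACTLY** (`k ≥ 5`): every `K₄⁻`-free graph on `Fin k` with `k + 1` edges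
has `Σ_v C(d(v), 2) ≤ C(k − 1, 2) + 4`, and the star plus two disjoint leaf edges attains it — the table's
`(5,6) 10 · (6,7) 14 · (7,8) 19 · (8,9) 25 · (9,10) 32` as one theorem. -/
theorem row_plus_one_exact (k : ℕ) (hk : 5 ≤ k) :
    (∀ (D : SimpleGraph (Fin k)) [DecidableRel D.Adj], K4mFree D → D.edgeFinset.card = k + 1 →
        cherries D ≤ (k - 1).choose 2 + 4) ∧
      ∃ (D : SimpleGraph (Fin k)) (_ : DecidableRel D.Adj),
        K4mFree D ∧ D.edgeFinset.card = k + 1 ∧ cherries D = (k - 1).choose 2 + 4 :=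
  ⟨fun D _ hK hD => cherries_le_of_card_edges_eq_succ k D hK hD, exists_k4mFree_row_plus_one k hk⟩

/-- The row's values in the census table: `10 · 14 · 19 · 25 · 32` at `k = 5 … 9`. -/
theorem row_plus_one_values :
    cherries (starPlusTwo 5) = 10 ∧ cherries (starPlusTwo 6) = 14 ∧ cherries (starPlusTwo 7) = 19 ∧
      cherries (starPlusTwo 8) = 25 ∧ cherries (starPlusTwo 9) = 32 := by
  refine ⟨?_, ?_, ?_, ?_, ?_⟩ <;> rw [cherries_starPlusTwo _ (by norm_num)] <;> decide

end C047

end TriangleCap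

end PercRepro
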